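import Literature.NumberTheory.Automorphic.IrreducibleClassesConstituents
import Literature.NumberTheory.Automorphic.JacquetModuleExactProofs
import HarnessLib

/-!
# Jacquet modules along chains of subrepresentations when every constituent has a non-zero Jacquet module

Generic representation theory (theorems only; no definition, no named fact, no instance) over ★ `Representation.jacquetMap` ∕
★ `ParabolicTriple.restrict` (`Automorphic/JacquetModule`), ★ exactness of the Jacquet functor (`Automorphic/JacquetModuleExactProofs`:
`jacquetMap_injective` ∕ `jacquetMap_exact` ∕ `jacquetMap_surjective`) and ★ `IrrClass.IsConstituentOf` (`Automorphic/IrreducibleClassesConstituents`).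
For a parabolic triple `t = (P, M, N)` of a topological group `G` with `N` a union of compact open subgroups (★ `IsLimitOfCompactOpen`):

* §1 `nontrivial_coinvariants_of_forall_isConstituentOf` — a smooth representation `τ ≠ 0` ALL OF WHOSE CONSTITUENTS have a non-zero Jacquet
  module has itself a non-zero Jacquet module (a constituent `N₁ ⁄ N₂` exists, ★ `IrrClass.exists_isConstituentOf`; `r(N₁) ↠ r(N₁ ⁄ N₂) ≠ 0`
  and `r(N₁) ↪ r(τ)`).
* §2 `map_coinvariantsMk_lt_of_lt` — STRICT MONOTONICITY: for subrepresentations `A < B` of such a `ρ`, the images of `A` and `B` in the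
  Jacquet module `r(ρ)` (under ★ `Representation.Coinvariants.mk`) satisfy `r(A) < r(B)` (exactness of `0 → A → B → B ⁄ A → 0` and §1 for
  `B ⁄ A`); hence `finrank` strictly increases (`finrank_map_coinvariantsMk_lt_of_lt`).
* §3 CONSEQUENCES for a finite-dimensional Jacquet module: no chain `⊥ < N₁ < N₂ < ⊤` when `finrank r(ρ) ≤ 2`
  (`not_lt_lt_lt_of_finrank_coinvariants_le_two` — the shape of ★ `UnitaryGroup.U3PrincipalSeriesLengthLeTwo`, [Casselman1995, Cor. 7.1.2]);
  a subrepresentation `⊥ ≠ N ≠ ⊤` has `finrank r(N) = 1` when `finrank r(ρ) = 2` (`finrank_coinvariants_eq_one_of_ne_bot_of_ne_top`, the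
  first step of [Casselman1995, Prop. 7.1.3]).
* §4 `normalizedJacquet_apply_eq_smul_of_finrank_eq_one` — if `r(σ)` is a line carrying a NON-ZERO `M`-map to the character `θ` (the
  Frobenius image of an embedding `σ ↪ i(θ)`), then `M` acts on `r(σ)` by `θ`, so every exponent of `σ` equals `θ` pointwise
  (`apply_eq_of_eigenvector_of_finrank_eq_one`).

Written for the T3 «KeysCaseTwo» pay-down of cell pub/hodgecm-mathlib F0∕P3 (junctions N3 ⇐ N1 + N2 and N5′ ⇐ N5 + N1 + N2), automorphic-free.

## References
[Casselman1995] W. Casselman, *Introduction to the theory of admissible representations of p-adic reductive groups* (draft 1 May 1995),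
Prop. 3.2.3 (exactness), Cor. 6.3.7, §7.1 Cor. 7.1.2, Prop. 7.1.3 · [BernsteinZelevinsky1977] §1.9 (a), §2.3, Thm. 2.8.
-/

set_option autoImplicit false

noncomputable section

namespace Representation

open Literature.NumberTheory.Automorphic Literature.NumberTheory.Automorphic.IrrClass
open Literature.RepresentationTheory.FiniteGroups Literature.RepresentationTheory.Semisimple

variable {G : Type*} [Group G] [TopologicalSpace G] [IsTopologicalGroup G] (t : ParabolicTriple G)

/-! ## §0 Plumbing: the inclusion of a subrepresentation followed by the quotient map is exact -/

section Plumbing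

variable {V : Type*} [AddCommGroup V] [Module ℂ V] {ρ : Representation ℂ G V}

omit [TopologicalSpace G] [IsTopologicalGroup G] in
/-- `0 → N → ρ → ρ ⁄ N → 0` is exact in the middle. [folklore] -/
private theorem exact_subtypeIntertwiningMap_mkQ_of_subrepresentation (N : Subrepresentation ρ) :
    Function.Exact (Subrepresentation.subtypeIntertwiningMap N) N.mkQ := by
  intro v
  rw [Subrepresentation.mkQ_eq_zero_iff]
  constructor
  · intro hv
    exact ⟨⟨v, hv⟩, rfl⟩
  · rintro ⟨w, rfl⟩
    exact w.2

end Plumbing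

/-! ## §1 A non-zero smooth representation all of whose constituents have `r ≠ 0` has `r ≠ 0` -/

/-- **If every constituent of a smooth `τ ≠ 0` has a non-zero Jacquet module, so does `τ`.**  Take a constituent `c ≅ N₁ ⁄ N₂`
(★ `IrrClass.exists_isConstituentOf`); its Jacquet module is non-zero by hypothesis (transported along the class equality and the
equivalence with the subquotient: a surjective `G`-map gives a surjective Jacquet map, ★ `jacquetMap_surjective`), so `r(N₁) ≠ 0`
(`r(N₁) ↠ r(N₁ ⁄ N₂)`) and `r(τ) ≠ 0` (`r(N₁) ↪ r(τ)`, ★ `jacquetMap_injective`). [cite: Casselman1995, Cor. 6.3.7 p. 59]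
[cite: BernsteinZelevinsky1977, §1.9 (a)] -/
theorem nontrivial_coinvariants_of_forall_isConstituentOf (hN : IsLimitOfCompactOpen t.N)
    {W : Type} [AddCommGroup W] [Module ℂ W] [Nontrivial W] (τ : Representation ℂ G W) (hτ : τ.IsSmooth)
    (h : ∀ c : IrrClass G, c.IsConstituentOf τ →
      ∃ r : SmoothIrrep G, IrrClass.mk r = c ∧ Nontrivial (t.restrict r.ρ).Coinvariants) :
    Nontrivial (t.restrict τ).Coinvariants := by
  obtain ⟨c, hc⟩ := IrrClass.exists_isConstituentOf τ hτ
  obtain ⟨r, hrc, hr⟩ := h c hc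
  obtain ⟨r', hr'c, N₁, N₂, _hle, ⟨e⟩⟩ := hc
  obtain ⟨e₀⟩ := (IrrClass.mk_eq_mk_iff r r').1 (hrc.trans hr'c.symm)
  -- the subquotient `N₁ ⁄ N₂` as the quotient of `ρ|_{N₁}` by `N₂ ∩ N₁`
  let N₂' : Subrepresentation N₁.toRepresentation :=
    ⟨N₂.toSubmodule.comap N₁.toSubmodule.subtype, fun g _ hx ↦ N₂.apply_mem_toSubmodule g hx⟩
  have e' : r.ρ.Equiv N₂'.quotientRep := e₀.trans e
  -- `r(N₁ ⁄ N₂) ≠ 0`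
  haveI h1 : Nontrivial (t.restrict N₂'.quotientRep).Coinvariants :=
    (jacquetMap_surjective t e'.symm.toIntertwiningMap e'.symm.toLinearEquiv.surjective).nontrivial
  -- `r(N₁) ≠ 0`
  haveI h2 : Nontrivial (t.restrict N₁.toRepresentation).Coinvariants :=
    (jacquetMap_surjective t N₂'.mkQ N₂'.mkQ_surjective).nontrivial
  -- `r(τ) ≠ 0`
  exact (jacquetMap_injective t hN hτ (Subrepresentation.subtypeIntertwiningMap N₁)
    (Subrepresentation.subtypeIntertwiningMap_injective N₁)).nontrivial

/-! ## §2 Strict monotonicity of the image in the Jacquet module along chains of subrepresentations -/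

section StrictMono

variable {V : Type} [AddCommGroup V] [Module ℂ V] {ρ : Representation ℂ G V}

/-- **Strict monotonicity.**  Let `ρ` be smooth with every constituent having a non-zero Jacquet module, and `A < B` subrepresentations.
Then the image of `A` in `r(ρ) = V_N` is STRICTLY smaller than the image of `B`: otherwise, pulling back along the injective Jacquet map
`r(B) ↪ r(ρ)` (★ `jacquetMap_injective`), `r(A ∩ B) → r(B)` is onto, so by exactness of `0 → A → B → B ⁄ A → 0` on Jacquet modules
(★ `jacquetMap_exact`, ★ `jacquetMap_surjective`) `r(B ⁄ A) = 0` — contradicting §1 for the non-zero smooth `B ⁄ A`, whose constituents are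
constituents of `ρ`. [cite: Casselman1995, Cor. 7.1.2 p. 67] [cite: BernsteinZelevinsky1977, Thm. 2.8] -/
theorem map_coinvariantsMk_lt_of_lt (hN : IsLimitOfCompactOpen t.N) (hρ : ρ.IsSmooth)
    (h : ∀ c : IrrClass G, c.IsConstituentOf ρ →
      ∃ r : SmoothIrrep G, IrrClass.mk r = c ∧ Nontrivial (t.restrict r.ρ).Coinvariants)
    {A B : Subrepresentation ρ} (hAB : A < B) :
    A.toSubmodule.map (Coinvariants.mk (t.restrict ρ)) < B.toSubmodule.map (Coinvariants.mk (t.restrict ρ)) := by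
  refine lt_of_le_of_ne (Submodule.map_mono hAB.le) fun hEq => ?_
  -- `A` read inside `ρ|_B`, and the quotient `U = B ⁄ A`
  let A' : Subrepresentation B.toRepresentation :=
    ⟨A.toSubmodule.comap B.toSubmodule.subtype, fun g _ hx ↦ A.apply_mem_toSubmodule g hx⟩
  obtain ⟨b, hbB, hbA⟩ := SetLike.exists_of_lt hAB
  haveI : Nontrivial (↥B.toSubmodule ⧸ A'.toSubmodule) :=
    ⟨⟨Submodule.Quotient.mk ⟨b, hbB⟩, 0, fun h0 => hbA ((Submodule.Quotient.mk_eq_zero A'.toSubmodule).1 h0)⟩⟩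
  have hUs : A'.quotientRep.IsSmooth := (hρ.toRepresentation B).quotientRep A'
  have hU : ∀ c : IrrClass G, c.IsConstituentOf A'.quotientRep →
      ∃ r : SmoothIrrep G, IrrClass.mk r = c ∧ Nontrivial (t.restrict r.ρ).Coinvariants :=
    fun c hc => h c ((hc.of_quotientRep A').of_subrepresentation B)
  haveI hnt : Nontrivial (t.restrict A'.quotientRep).Coinvariants :=
    nontrivial_coinvariants_of_forall_isConstituentOf t hN A'.quotientRep hUs hU
  have hex : Function.Exact (jacquetMap t (Subrepresentation.subtypeIntertwiningMap A')) (jacquetMap t A'.mkQ) :=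
    jacquetMap_exact t _ _ (exact_subtypeIntertwiningMap_mkQ_of_subrepresentation A') A'.mkQ_surjective
  have hinjB := jacquetMap_injective t hN hρ (Subrepresentation.subtypeIntertwiningMap B)
    (Subrepresentation.subtypeIntertwiningMap_injective B)
  -- the Jacquet map of `B → B ⁄ A` vanishes identically
  have hzero : ∀ z, jacquetMap t A'.mkQ z = 0 := by
    intro z
    obtain ⟨y, rfl⟩ := Coinvariants.mk_surjective _ z
    have hy : Coinvariants.mk (t.restrict ρ) (y : V) ∈ A.toSubmodule.map (Coinvariants.mk (t.restrict ρ)) := by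
      rw [hEq]
      exact ⟨y, y.2, rfl⟩
    obtain ⟨a, ha, hay⟩ := hy
    have h1 : jacquetMap t (Subrepresentation.subtypeIntertwiningMap B) (Coinvariants.mk _ ⟨a, hAB.le ha⟩) =
        jacquetMap t (Subrepresentation.subtypeIntertwiningMap B) (Coinvariants.mk _ y) := by
      rw [jacquetMap_mk, jacquetMap_mk]
      exact hay
    have h2 := hinjB h1
    refine (hex _).2 ⟨Coinvariants.mk _ ⟨⟨a, hAB.le ha⟩, ha⟩, ?_⟩
    rw [jacquetMap_mk, ← h2]
    rfl
  obtain ⟨x, hx⟩ := exists_ne (0 : (t.restrict A'.quotientRep).Coinvariants)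
  obtain ⟨z, rfl⟩ := jacquetMap_surjective t A'.mkQ A'.mkQ_surjective x
  exact hx (hzero z)

/-- `finrank` form of strict monotonicity (finite-dimensional Jacquet module). [cite: Casselman1995, Cor. 7.1.2 p. 67] -/
theorem finrank_map_coinvariantsMk_lt_of_lt (hN : IsLimitOfCompactOpen t.N) (hρ : ρ.IsSmooth)
    (h : ∀ c : IrrClass G, c.IsConstituentOf ρ →
      ∃ r : SmoothIrrep G, IrrClass.mk r = c ∧ Nontrivial (t.restrict r.ρ).Coinvariants)
    [FiniteDimensional ℂ (t.restrict ρ).Coinvariants] {A B : Subrepresentation ρ} (hAB : A < B) :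
    Module.finrank ℂ ↥(A.toSubmodule.map (Coinvariants.mk (t.restrict ρ))) <
      Module.finrank ℂ ↥(B.toSubmodule.map (Coinvariants.mk (t.restrict ρ))) :=
  Submodule.finrank_lt_finrank_of_lt (map_coinvariantsMk_lt_of_lt t hN hρ h hAB)

/-- The image of `N` in `r(ρ)` IS `r(N)`: `finrank r(N) = finrank (image of N)` (the Jacquet map of `N ↪ ρ` is injective, ★
`jacquetMap_injective`, with range the image of `N` under ★ `Coinvariants.mk`). [cite: Casselman1995, Prop. 3.2.3 p. 34] -/
theorem finrank_coinvariants_toRepresentation_eq (hN : IsLimitOfCompactOpen t.N) (hρ : ρ.IsSmooth) (N : Subrepresentation ρ) :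
    Module.finrank ℂ (t.restrict N.toRepresentation).Coinvariants =
      Module.finrank ℂ ↥(N.toSubmodule.map (Coinvariants.mk (t.restrict ρ))) := by
  have hinj := jacquetMap_injective t hN hρ (Subrepresentation.subtypeIntertwiningMap N)
    (Subrepresentation.subtypeIntertwiningMap_injective N)
  have hrange : LinearMap.range (jacquetMap t (Subrepresentation.subtypeIntertwiningMap N)).toLinearMap =
      N.toSubmodule.map (Coinvariants.mk (t.restrict ρ)) := by
    apply le_antisymm
    · rintro _ ⟨z, rfl⟩
      obtain ⟨y, rfl⟩ := Coinvariants.mk_surjective _ z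
      exact ⟨y, y.2, rfl⟩
    · rintro _ ⟨v, hv, rfl⟩
      exact ⟨Coinvariants.mk _ ⟨v, hv⟩, rfl⟩
  rw [← hrange]
  exact (LinearMap.finrank_range_of_inj hinj).symm

end StrictMono

/-! ## §3 Consequences for a finite-dimensional Jacquet module -/

section Consequences

variable {V : Type} [AddCommGroup V] [Module ℂ V] {ρ : Representation ℂ G V}

/-- **No chain `⊥ < N₁ < N₂ < ⊤` when `finrank r(ρ) ≤ 2`** (and every constituent of the smooth `ρ` has `r ≠ 0`): the four images
in `r(ρ)` would have strictly increasing dimensions `0 ≤ · < · < · < · ≤ 2`.  The shape of ★ `UnitaryGroup.U3PrincipalSeriesLengthLeTwo`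
(«Suppose one has a composition series `0 ⊊ I₁ ⊊ I₂ ⊊ I₃ = I` … contradiction»). [cite: Casselman1995, Cor. 7.1.2 p. 67]
[cite: BernsteinZelevinsky1977, Thm. 2.8] -/
theorem not_bot_lt_lt_lt_top_of_finrank_coinvariants_le_two (hN : IsLimitOfCompactOpen t.N) (hρ : ρ.IsSmooth)
    (h : ∀ c : IrrClass G, c.IsConstituentOf ρ →
      ∃ r : SmoothIrrep G, IrrClass.mk r = c ∧ Nontrivial (t.restrict r.ρ).Coinvariants)
    [FiniteDimensional ℂ (t.restrict ρ).Coinvariants] (h2 : Module.finrank ℂ (t.restrict ρ).Coinvariants ≤ 2)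
    (N₁ N₂ : Subrepresentation ρ) : ¬ (⊥ < N₁ ∧ N₁ < N₂ ∧ N₂ < ⊤) := by
  rintro ⟨h01, h12, h2t⟩
  have a := finrank_map_coinvariantsMk_lt_of_lt t hN hρ h h01
  have b := finrank_map_coinvariantsMk_lt_of_lt t hN hρ h h12
  have c := finrank_map_coinvariantsMk_lt_of_lt t hN hρ h h2t
  have d : Module.finrank ℂ ↥((⊤ : Subrepresentation ρ).toSubmodule.map (Coinvariants.mk (t.restrict ρ))) ≤
      Module.finrank ℂ (t.restrict ρ).Coinvariants := Submodule.finrank_le _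
  omega

/-- **A proper non-zero subrepresentation has a one-dimensional Jacquet module when `finrank r(ρ) = 2`** (and every constituent of
the smooth `ρ` has `r ≠ 0`): `0 ≤ dim r(⊥) < dim r(N) < dim r(⊤) ≤ 2`.  First step of [Casselman1995, Prop. 7.1.3].
[cite: Casselman1995, Prop. 7.1.3 p. 67] -/
theorem finrank_coinvariants_eq_one_of_ne_bot_of_ne_top (hN : IsLimitOfCompactOpen t.N) (hρ : ρ.IsSmooth)
    (h : ∀ c : IrrClass G, c.IsConstituentOf ρ →
      ∃ r : SmoothIrrep G, IrrClass.mk r = c ∧ Nontrivial (t.restrict r.ρ).Coinvariants)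
    [FiniteDimensional ℂ (t.restrict ρ).Coinvariants] (h2 : Module.finrank ℂ (t.restrict ρ).Coinvariants = 2)
    {N : Subrepresentation ρ} (hbot : N ≠ ⊥) (htop : N ≠ ⊤) :
    Module.finrank ℂ (t.restrict N.toRepresentation).Coinvariants = 1 := by
  have a := finrank_map_coinvariantsMk_lt_of_lt t hN hρ h (bot_lt_iff_ne_bot.2 hbot)
  have b := finrank_map_coinvariantsMk_lt_of_lt t hN hρ h (lt_top_iff_ne_top.2 htop)
  have d : Module.finrank ℂ ↥((⊤ : Subrepresentation ρ).toSubmodule.map (Coinvariants.mk (t.restrict ρ))) ≤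
      Module.finrank ℂ (t.restrict ρ).Coinvariants := Submodule.finrank_le _
  rw [finrank_coinvariants_toRepresentation_eq t hN hρ N]
  omega

end Consequences

/-! ## §4 A line carrying a non-zero `M`-map to a character: `M` acts by that character -/

section Line

variable [LocallyCompactSpace t.P] {W : Type*} [AddCommGroup W] [Module ℂ W] (σ : Representation ℂ G W)

/-- **If `r(σ)` is one-dimensional and carries a NON-ZERO `M`-map to the character `θ`** (e.g. the Frobenius image of an embedding
`σ ↪ i(θ)`, ★ `frobenius_normalizedInd`), **then `M` acts on `r(σ)` by `θ`**: the map is injective on the line and intertwines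
`r(σ)` with `ℂ_θ`. [cite: Casselman1995, Prop. 7.1.3 p. 67; Thm. 3.2.4] [cite: BernsteinZelevinsky1977, Prop. 1.9 (b)] -/
theorem normalizedJacquet_apply_eq_smul_of_finrank_eq_one (θ : ↥t.M →* ℂˣ)
    (h1 : Module.finrank ℂ (t.restrict σ).Coinvariants = 1)
    (φ : (σ.normalizedJacquet t).IntertwiningMap ((Representation.trivial ℂ ↥t.M ℂ).twist θ)) (hφ : φ ≠ 0)
    (m : ↥t.M) (x : (t.restrict σ).Coinvariants) :
    σ.normalizedJacquet t m x = ((θ m : ℂˣ) : ℂ) • x := by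
  -- `φ` is injective on the line `r(σ)`
  haveI : FiniteDimensional ℂ (t.restrict σ).Coinvariants := Module.finite_of_finrank_eq_succ h1
  have hφinj : Function.Injective φ := by
    have hker : LinearMap.ker φ.toLinearMap ≠ ⊤ := by
      intro htop
      apply hφ
      refine Representation.IntertwiningMap.ext (LinearMap.ext fun y => ?_)
      have hy : y ∈ LinearMap.ker φ.toLinearMap := htop ▸ Submodule.mem_top
      simpa using hy
    have hker0 : LinearMap.ker φ.toLinearMap = ⊥ := by
      haveI := is_simple_module_of_finrank_eq_one (K := ℂ) (A := ℂ) h1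
      rcases IsSimpleOrder.eq_bot_or_eq_top (LinearMap.ker φ.toLinearMap) with h0 | h0
      · exact h0
      · exact (hker h0).elim
    exact LinearMap.ker_eq_bot.1 hker0
  apply hφinj
  rw [map_smul, Representation.IntertwiningMap.isIntertwining, Representation.twist_apply, Representation.trivial_apply]

/-- Hence **every exponent of such a `σ` equals `θ` pointwise** (★ `Representation.HasJacquetExponent`: an eigenvector `w ≠ 0` with
eigencharacter `χ'` has `χ' m • w = θ m • w`; stated on the raw eigenvector so that this file does not import the exponent
vocabulary). [cite: Casselman1995, §4.4 p. 45; Prop. 7.1.3 p. 67] -/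
theorem apply_eq_of_eigenvector_of_finrank_eq_one (θ : ↥t.M →* ℂˣ)
    (h1 : Module.finrank ℂ (t.restrict σ).Coinvariants = 1)
    (φ : (σ.normalizedJacquet t).IntertwiningMap ((Representation.trivial ℂ ↥t.M ℂ).twist θ)) (hφ : φ ≠ 0)
    {χ' : ↥t.M →* ℂˣ} {w : (t.restrict σ).Coinvariants} (hw0 : w ≠ 0)
    (hw : ∀ m : ↥t.M, σ.normalizedJacquet t m w = ((χ' m : ℂˣ) : ℂ) • w) (m : ↥t.M) :
    ((χ' m : ℂˣ) : ℂ) = ((θ m : ℂˣ) : ℂ) := by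
  have e := (hw m).symm.trans (normalizedJacquet_apply_eq_smul_of_finrank_eq_one t σ θ h1 φ hφ m w)
  exact smul_left_injective ℂ hw0 e

end Line

end Representation

end
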